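import Summits.ABC.IUTFork.Thm311RealInd1UnitsShear
import Summits.ABC.IUTFork.Thm311RealInd1StripLattices
import Summits.ABC.IUTFork.Cor312TameQuadMoverInstance
import HarnessLib

/-!
# The unit-group shear at `v₇ = (√7)` of `ℚ(√7)`, IV: THE STRIP WIRING — the R9f `∃`-horn is exactly
# the lifting statement, in print's own currency

Record file (D-0012) of the abc-iut cell (TEAM R, lead seat abc-iut-c312-14 = R1, gen 7); sequel of
`Thm311RealInd1UnitsShear.lean`, closing the answer to abc-iut-c312-1 (gen 8)'s 2026-08-26T16:41:26Z
«disprover-wanted» print-(Ind1)-MOVER question (the R9f OPEN POINT of `Thm311RealInd1StripLattices.lean`).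
TAKES NO SIDE on [IUTchIII] Cor. 3.12.

CONTENT.  Over c312-1's criterion file (p456209: a realised strip automorphism fixes a sub-lattice `M`
iff THE units transport fixes `unitPreimage L M`), this file wires the freedom theorem of the prequel
into print's own currency at `v₇`, for THE analytic logarithm `L = Real.analyticLogv`:

* `analyticLogv_v7_eq` — `L(u) = e₇⁻¹(log₇(x u))`: the analytic-log binder at `v₇` IS abc-iut-S1's
  `unitLog` in `K₇` (the `p = residueChar`-form of `analyticLogv_apply`, transported to `p = 7`);
* `M2` — the `μ·U^{(2)}`-shaped sub-lattice `{y : ‖y‖' ≤ ‖Ω‖²} = log-image of the second unit group`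
  (an `𝒪_{v₇}`-ideal-shaped region, the shape of the Θ-pilot regions), with
  `M2_subset_range` (it is inside `L(𝒪_{v₇}^×)`) and `mem_M2_iff`;
* `unitPreimage_M2_mover` — **the criterion-currency freedom clause**: `u₀ ∈ unitPreimage L M2` with
  `shearFun u₀ ∉ unitPreimage L M2` — `unitPreimage L M2` IS the tree spelling of `μ·U_{v₇}^{(2)}`;
* `psiShear` — the bicontinuous additive realisation `ψ = e₇⁻¹ ∘ g ∘ e₇` of the shear on `K_{v₇}`, with
  `realises_psiShear`: **for any `φ ∈ Aut_top(G_{v₇})` whose units transport is the shear**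
  (`liftUnits v₇ φ = shearFun`), `ψ` realises `stripMulAut v₇ φ` through `L`;
* **`ind1_strip_mover_of_lift`** — the `∃`-horn of R9f, CONDITIONAL on the lifting statement: if some
  `φ ∈ Aut_top(G_{v₇})` has `liftUnits v₇ φ = shearFun`, then print's (Ind1) strip part at `v₇` MOVES
  the ideal-shaped sub-lattice `M2`: `∃ ψ ∈ Real.ind1StripOf v₇ L, ψ''(M2) ≠ M2` — the print-reading
  analogue of the Dupuy–Hilado (Ind2)-movers of record (`exists_ismDH_moves_smul_shell`); and
  `liftUnits_moves_muU2_of_lift`, the ask's verbatim form `u ∈ μ·U^{(2)} ∧ liftUnits v₇ φ u ∉ μ·U^{(2)}`.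

STATUS OF THE HYPOTHESIS.  The lifting statement «∃ φ : Gal v₇ ≃ₜ* Gal v₇, ∀ u, liftUnits v₇ φ u =
shearFun u» is the `d = 2` RESIDUAL of the R9f question (GAP-LEDGER row G-c312-14-R9f): c312-1 g9's
parallel landing (`Thm311RealInd1StripTwistMover.lean`, p467710; GAP row G-c312-1-g9-1) reduces the
`∃`-horn at `[K_v : ℚ_p] ≥ 3`, `f = 1` to Jannsen–Wingberg TRANSVECTIONS held in print (K. Kondo,
arXiv:2512.09231, §2 Thm 2.3; NSW Thm 7.5.14) — a Literature-typing away from unconditional movers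
THERE; at `d = 2` (this file's `v₇`, every tame quadratically ramified place) no published construction
is located: Mochizuki (Int. J. Math. 8 (1997)) forces a mover `φ` to be non-geometric, the prequel shows
no norm-rigidity argument refutes the shear, and Kondo's transvection machine does not reach `d = 2`.
Neutral: both horns of the `d = 2` case stay open in the tree; this file pins WHERE the question lives.  [cite: MochizukiAbsAnab2004, Prop 1.2.1 (iii) p.10]
[cite: DupuyHilado2025, §4.9] [claim: Mochizuki2012, status: disputed] for every [IUTchIII] locution.
Nothing here asserts or refutes [IUTchIII] Cor. 3.12; typed ≠ proved.
-/

set_option autoImplicit false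

noncomputable section

namespace Summit.ABC.IUTFork.Thm311.Real.UnitsShear

open Literature.IUT.LogVolume Literature.NumberTheory.NumberFields
open NumberField IsDedekindDomain Metric IsUltrametricDist
open Summit.ABC.IUTFork.RamifiedMover
open Summit.ABC.IUTFork.Thm311.Real

/-! ## 1. The analytic logarithm at `v₇` is `unitLog` in `K₇` -/

/-- **The analytic-log binder at `v₇` is `unitLog` in `K₇`**: `analyticLogv F₇ v₇ u = e₇⁻¹(log₇(x u))`
(`analyticLogv_apply` at `p = residueChar`, transported to `p = 7` along R1-g2's `logVolume_residueChar_v7`). [folklore] -/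
theorem analyticLogv_v7_eq (u : (↥(v7.adicCompletionIntegers ↥F7))ˣ) :
    analyticLogv ↥F7 v7 (Additive.ofMul u) = e7.symm (unitLog (xval u)) := by
  have hgen : ∀ (p : ℕ) (hp : p = Literature.IUT.LogVolume.residueChar ↥F7 v7)
      (hv : ((p : ℕ) : 𝓞 ↥F7) ∈ v7.asIdeal),
      (RescaledCompletion.of ↥F7 p v7 hv).symm
        (haveI : Fact p.Prime := hp ▸ ⟨Literature.IUT.LogVolume.residueChar_prime ↥F7 v7⟩
         unitLog (RescaledCompletion.of ↥F7 p v7 hv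
          (((u : ↥(v7.adicCompletionIntegers ↥F7)) : v7.adicCompletion ↥F7)))) =
      analyticLogv ↥F7 v7 (Additive.ofMul u) := by
    intro p hp hv
    subst hp
    exact (analyticLogv_apply ↥F7 v7 u).symm
  exact (hgen 7 logVolume_residueChar_v7.symm seven_mem_v7).symm

/-- **`L₇` — the analytic logarithm at `v₇`, read at the plain completion types** (the same term as
`analyticLogv ↥F7 v7`, `L7_def`; the definitional re-typing keeps every statement below syntactically
over `𝒪_{v₇}^×` and `K_{v₇}`). [folklore] -/
def L7 : Additive (↥(v7.adicCompletionIntegers ↥F7))ˣ →+ v7.adicCompletion ↥F7 :=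
  analyticLogv ↥F7 v7

/-- `L₇` IS the analytic-logarithm binder at `v₇` (definitionally). [folklore] -/
theorem L7_def : L7 = analyticLogv ↥F7 v7 := rfl

/-- `L₇(u) = e₇⁻¹(log₇(x u))`. [folklore] -/
theorem L7_apply (u : (↥(v7.adicCompletionIntegers ↥F7))ˣ) :
    L7 (Additive.ofMul u) = e7.symm (unitLog (xval u)) :=
  analyticLogv_v7_eq u

/-! ## 2. The `μ·U^{(2)}`-shaped sub-lattice `M₂` -/

/-- **The ideal-shaped sub-lattice `M₂ ⊆ K_{v₇}`**: the elements of rescaled norm `≤ ‖Ω‖²` — the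
log-image of the second unit group `U^{(2)}`, an `𝒪_{v₇}`-ideal-shaped region (the shape of the
Θ-pilot regions). [claim: Mochizuki2012, status: disputed] -/
def M2 : AddSubgroup (v7.adicCompletion ↥F7) where
  carrier := {y | ‖e7 y‖ ≤ ‖Omega‖ ^ 2}
  add_mem' := by
    intro a b ha hb
    rw [Set.mem_setOf_eq, map_add]
    exact (norm_add_le_max _ _).trans (max_le ha hb)
  zero_mem' := by
    rw [Set.mem_setOf_eq, map_zero, norm_zero]
    positivity
  neg_mem' := by
    intro a ha
    rw [Set.mem_setOf_eq, map_neg, norm_neg]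
    exact ha

/-- Membership in `M₂`. [folklore] -/
theorem mem_M2_iff (y : v7.adicCompletion ↥F7) : y ∈ M2 ↔ ‖e7 y‖ ≤ ‖Omega‖ ^ 2 := Iff.rfl

/-- **`M₂ ⊆ L(𝒪_{v₇}^×)`**: every element of `M₂` is an analytic-log value of a unit (the tame
equality clause `log₇(𝒪^×) = B(0, ‖Ω‖) ⊇ B(0, ‖Ω‖²)`). [folklore] -/
theorem M2_subset_range :
    (M2 : Set (v7.adicCompletion ↥F7)) ⊆
      Set.range fun u : (↥(v7.adicCompletionIntegers ↥F7))ˣ => L7 (Additive.ofMul u) := by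
  intro y hy
  rw [SetLike.mem_coe, mem_M2_iff] at hy
  have hball : e7 y ∈ closedBall (0 : K7) ‖Omega‖ := by
    rw [mem_closedBall_zero_iff]
    refine hy.trans ?_
    obtain ⟨h0, h1⟩ := norm_omega_pos_lt_one
    nlinarith
  rw [← logUnits_eq_ball] at hball
  obtain ⟨x, hx1, hxlog⟩ := hball
  rw [Set.mem_setOf_eq] at hx1
  refine ⟨unitOf hx1, ?_⟩
  show L7 (Additive.ofMul (unitOf hx1)) = y
  rw [L7_apply, xval_unitOf, hxlog]
  exact (e7.symm_apply_apply y)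

/-! ## 3. The criterion-currency freedom clause: `unitPreimage L M₂` is moved -/

/-- **THE CRITERION-CURRENCY MOVER**: `unitPreimage L M₂` — the tree spelling of `μ·U_{v₇}^{(2)}`
(c312-1's p456209) — contains a `u₀` with `shearFun u₀ ∉ unitPreimage L M₂`.  Combined with
`image_subset_iff_liftUnits_mapsTo`: IF some `φ ∈ Aut_top(G_{v₇})` has `liftUnits v₇ φ = shearFun`,
every `ψ` realising it moves the ideal-shaped region `M₂`. [claim: Mochizuki2012, status: disputed] -/
theorem unitPreimage_M2_mover :
    ∃ u₀ : (↥(v7.adicCompletionIntegers ↥F7))ˣ,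
      u₀ ∈ unitPreimage L7 M2 ∧
        shearFun u₀ ∉ unitPreimage L7 M2 := by
  have h7K : ‖(7 : K7)‖ ≤ ‖Omega‖ ^ 2 := by rw [norm_seven_K7]
  obtain ⟨x₀, hx₀b, hx₀l⟩ := exists_logSeries_eq 7 K7 theta_rad2_lt_one h7K
  have hx₀n : ‖x₀‖ = 1 :=
    norm_eq_one_of_norm_one_sub_lt (lt_of_le_of_lt hx₀b norm_omega_sq_lt_one)
  have hlog₀ : unitLog (xval (unitOf hx₀n)) = (7 : K7) := by
    rw [xval_unitOf, unitLog_of_isPrincipal 7 (lt_of_le_of_lt hx₀b norm_omega_sq_lt_one), hx₀l]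
  refine ⟨unitOf hx₀n, ?_, ?_⟩
  · rw [mem_unitPreimage_iff, L7_apply, mem_M2_iff, e7.apply_symm_apply, hlog₀]
    exact h7K
  · rw [mem_unitPreimage_iff, L7_apply, mem_M2_iff, e7.apply_symm_apply,
      unitLog_xval_shearFun, hlog₀, glin_apply, dcoef_seven, one_smul, norm_seven_add_omega]
    obtain ⟨h0, h1⟩ := norm_omega_pos_lt_one
    push Not
    nlinarith

/-! ## 4. The realisation `ψ = e₇⁻¹ ∘ g ∘ e₇` and the conditional (Ind1)-mover -/

/-- **The realisation of the shear on `K_{v₇}`**: the additive automorphism `ψ = e₇⁻¹ ∘ g ∘ e₇`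
(`ℚ₇`-linear, hence bicontinuous). [folklore] -/
def psiShear : v7.adicCompletion ↥F7 ≃+ v7.adicCompletion ↥F7 :=
  (e7.toAddEquiv.trans gequiv.toAddEquiv).trans e7.symm.toAddEquiv

/-- `ψ` applied. [folklore] -/
theorem psiShear_apply (x : v7.adicCompletion ↥F7) : psiShear x = e7.symm (glin (e7 x)) := rfl

/-- `ψ⁻¹` applied (`g` is an involution). [folklore] -/
theorem psiShear_symm_apply (x : v7.adicCompletion ↥F7) :
    psiShear.symm x = e7.symm (glin (e7 x)) := rfl

/-- `ψ` is continuous (finite dimension; `e₇` is the identity of the underlying uniform space).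
[folklore] -/
theorem continuous_psiShear : Continuous ⇑psiShear := by
  haveI : FiniteDimensional ℚ_[7] K7 := Module.finite_of_finrank_eq_succ finrank_K7
  exact LinearMap.continuous_of_finiteDimensional (gequiv : K7 →ₗ[ℚ_[7]] K7)

/-- `ψ⁻¹` is continuous. [folklore] -/
theorem continuous_psiShear_symm : Continuous ⇑psiShear.symm := by
  haveI : FiniteDimensional ℚ_[7] K7 := Module.finite_of_finrank_eq_succ finrank_K7
  exact LinearMap.continuous_of_finiteDimensional (gequiv : K7 →ₗ[ℚ_[7]] K7)

/-- **`ψ` realises `stripMulAut v₇ φ` through the analytic logarithm, for ANY `φ` whose units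
transport is the shear.** [claim: Mochizuki2012, status: disputed] -/
theorem realises_psiShear {φ : Gal v7 ≃ₜ* Gal v7}
    (hφ : ∀ u, liftUnits v7 φ u = shearFun u) :
    Realises v7 L7 (stripMulAut v7 φ) psiShear := by
  rw [realises_stripMulAut_iff]
  intro u
  rw [hφ, L7_apply, L7_apply, psiShear_apply, e7.apply_symm_apply, ← unitLog_xval_shearFun]

/-- Under the lifting hypothesis, `ψ` is in print's (Ind1) strip part at `v₇`. [claim: Mochizuki2012, status: disputed] -/
theorem psiShear_mem_ind1StripOf {φ : Gal v7 ≃ₜ* Gal v7}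
    (hφ : ∀ u, liftUnits v7 φ u = shearFun u) :
    psiShear ∈ ind1StripOf v7 L7 :=
  ⟨continuous_psiShear, continuous_psiShear_symm, φ, realises_psiShear hφ⟩

/-- **`ψ` moves `M₂`**: `ψ''(M₂) ≠ M₂` (unconditionally — `ψ(e₇⁻¹ 7) = e₇⁻¹(7 + Ω)` escapes).
[folklore] -/
theorem psiShear_moves_M2 : ⇑psiShear '' (M2 : Set (v7.adicCompletion ↥F7)) ≠ M2 := by
  intro hEq
  have h7m : e7.symm (7 : K7) ∈ M2 := by
    rw [mem_M2_iff, e7.apply_symm_apply, norm_seven_K7]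
  have hmem : psiShear (e7.symm (7 : K7)) ∈ ⇑psiShear '' (M2 : Set (v7.adicCompletion ↥F7)) :=
    ⟨e7.symm (7 : K7), h7m, rfl⟩
  rw [hEq] at hmem
  rw [SetLike.mem_coe, mem_M2_iff, psiShear_apply, e7.apply_symm_apply, e7.apply_symm_apply,
    glin_apply, dcoef_seven, one_smul, norm_seven_add_omega] at hmem
  obtain ⟨h0, h1⟩ := norm_omega_pos_lt_one
  nlinarith

/-- **THE CONDITIONAL (Ind1)-MOVER** (the `∃`-horn of c312-1's R9f question, modulo exactly the
lifting statement): IF some `φ ∈ Aut_top(G_{v₇})` has units transport the shear, THEN print's (Ind1)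
strip part at `v₇` (over the analytic logarithm) MOVES the ideal-shaped sub-lattice `M₂` — the
print-reading analogue of the Dupuy–Hilado (Ind2)-movers of record.  The hypothesis is GAP-LEDGER row
G-c312-14-R9f; the prequel (`exists_normRigid_involution_moves_muU2`) shows no norm-rigidity argument
refutes it. [cite: DupuyHilado2025, §4.9] [claim: Mochizuki2012, status: disputed] -/
theorem ind1_strip_mover_of_lift
    (hlift : ∃ φ : Gal v7 ≃ₜ* Gal v7, ∀ u, liftUnits v7 φ u = shearFun u) :
    ∃ ψ ∈ ind1StripOf v7 L7,
      ⇑ψ '' (M2 : Set (v7.adicCompletion ↥F7)) ≠ M2 := by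
  obtain ⟨φ, hφ⟩ := hlift
  exact ⟨psiShear, psiShear_mem_ind1StripOf hφ, psiShear_moves_M2⟩

/-- **The ask's verbatim form**: under the lifting hypothesis there are `φ` and `u ∈ μ·U^{(2)}`
(spelled `unitPreimage L M₂`, c312-1's criterion currency) with `liftUnits v₇ φ u ∉ μ·U^{(2)}` —
print's (Ind1) units transport moves the second unit group. [claim: Mochizuki2012, status: disputed] -/
theorem liftUnits_moves_muU2_of_lift
    (hlift : ∃ φ : Gal v7 ≃ₜ* Gal v7, ∀ u, liftUnits v7 φ u = shearFun u) :
    ∃ (φ : Gal v7 ≃ₜ* Gal v7) (u : (↥(v7.adicCompletionIntegers ↥F7))ˣ),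
      u ∈ unitPreimage L7 M2 ∧
        liftUnits v7 φ u ∉ unitPreimage L7 M2 := by
  obtain ⟨φ, hφ⟩ := hlift
  obtain ⟨u₀, h1, h2⟩ := unitPreimage_M2_mover
  exact ⟨φ, u₀, h1, by rw [hφ]; exact h2⟩

end Summit.ABC.IUTFork.Thm311.Real.UnitsShear

end
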